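import Literature.Topology.FourManifolds.AttachingMapAdaptedFlowout
import Literature.Topology.FourManifolds.OpenCollarExistence
import Literature.Topology.FourManifolds.CollarCriterion
import Literature.Topology.FourManifolds.GluingProofs
import HarnessLib

/-!
# Dual handles, V: the seam in standard form — re-gluing `M = X ∪_Ψ W` from an open collar of
# `∂X` adapted to the belt tubes and a collar of `∂W` matched with its open collar
(brick (ii-a) of the sub-goal T3b "the complement of the prefix sub-handlebody is the other piece
with the DUAL suffix handles" of stub `stub_steinRealisation` (NF6), line `modp-braid-orbits` r11,
crux `ConvexBisection.AcyclicBisectionExists`, item stmt-SmoothPoincare4-10508; wave 2, lead c5)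

The dual presentation of the complement piece `W₂ = W ∪ (dual handles)` inside a closed gluing
`M = X ∪_Ψ W` requires maps CROSSING THE SEAM smoothly (the embedding of `W ∖ Ψ(belt circles)`
into `W₂` stretches a neighbourhood of each dual core across the seam, see the T3b report).  Since
the gluing is unique up to diffeomorphism (the tree's `nonempty_diffeomorph_of_isBoundaryGluing_holds`,
Hirsch 1976 Ch. 8 Thm. 2.1) and `IsBoundaryGluing` transports along diffeomorphisms of the glued
manifold (`IsBoundaryGluing.diffeomorph_comp`), one may REPLACE `M` by Milnor's explicit gluing
`G.d₂.Glued` (`BoundaryGluingConstruction.lean`, Milnor 1965 Thm. 1.4) built from open collars of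
our choice, in which the seam piece `∂X × ℝ` is a chart: `jM (CM z t) = ι (z, t)` (`t ≥ 0`),
`jN (CN (Ψ z) s) = ι (z, -s)` (`s ≥ 0`).  This file supplies the collars:

* `exists_openCollar_adapted` — **an open collar of `∂X` adapted to a finite family of attaching
  maps of 2-handles** (e.g. the belt maps `beltMap D j` of the suffix handles): its collar lines
  through the sphere part of each tube near the attaching circle are the DEPTH LINES of the tube,
  `C.toFun z s = f i (depthLine θ v (collarStretch a s))` for `incl z = f i (depthLine θ v 0)`,
  `‖v‖ ≤ 1/2`, `collarStretch a s ≤ min (1/5) a` (the tree's `exists_adapted_flowout`, Milnor's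
  flow-out collar with prescribed germs, packaged as a long open collar `Cover.openCollar`);
* `exists_openCollar_collar_eq` — **an open collar `CN` of an arbitrary boundary datum `bW` of `W`
  together with a collar `col` of the CANONICAL boundary datum of `W` from the same flow-out**,
  related by `col (w, t) = CN.toFun x (t / (2 - t))` whenever `incl w = bW.incl x` (so that the
  dual attaching maps `dualMap … col …`, which are prolonged along `col`, read in the seam chart);
* `exists_diffeomorph_glued` — **standard form of the seam**: for any open collars `CM`, `CN`,
  `M ≅ (⟨CM, CN, Ψ⟩ : BoundaryGlueData bX bW).d₂.Glued`.

Everything here is proved; no named facts.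

## References
* J. Milnor, *Lectures on the h-cobordism theorem* (1965), Thm. 1.4 and proof of Thm. 3.4.
  [MilnorHCobordism1965]
* M. W. Hirsch, *Differential Topology* (1976), Ch. 8 §2, Thm. 2.1. [HirschDT1976]
* A. A. Kosinski, *Differential Manifolds* (1993), VI §5 (independence of the extension `h̄`).
  [Kosinski1993]
-/

noncomputable section

-- the prescribed namespace `Summit.<P>.<Sub>.…` duplicates `SmoothPoincare4` (P = Sub)
set_option linter.dupNamespace false

open scoped Manifold ContDiff Topology

namespace Summit.SmoothPoincare4.SmoothPoincare4.Theorems.AcyclicBisectionExists.ModpBraidOrbits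

open Set Function
open Literature.Topology.FourManifolds Literature.Topology.FourManifolds.HandleAttachingMap

universe u

/-! ### §1 An open collar of `∂X` adapted to a family of attaching maps -/

section Adapted

variable {X : Type u} [TopologicalSpace X] [T2Space X] [CompactSpace X]
  [ChartedSpace (EuclideanHalfSpace 4) X] [IsManifold (𝓡∂ 4) ∞ X]

/-- **An open collar of `∂X` adapted to a finite family of attaching maps of 2-handles.**  For a
finite family `f` of attaching maps with pairwise disjoint ranges on the compact `X` and a boundary
datum `b` of `X` with nonempty carrier, there is a long open collar `C` of `b` and `a > 0` such that
the collar line through the sphere point `f i (depthLine θ v 0)` (`‖v‖ ≤ 1/2`) IS the depth line: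
`C.toFun z s = f i (depthLine θ v (collarStretch a s))` whenever `b.incl z = f i (depthLine θ v 0)`,
`0 ≤ s` and `collarStretch a s ≤ min (1/5) a` (Milnor's flow-out collar with the depth fields of
the tubes blended in: the tree's `exists_adapted_flowout`, packaged by `Cover.openCollar`).
[cite: MilnorHCobordism1965, proof of Thm. 3.4] -/
theorem exists_openCollar_adapted {ι : Type*} [Finite ι] (f : ι → HandleAttachingMap 3 2 X)
    (hdisj : Pairwise fun i j => Disjoint (range (f i).toFun) (range (f j).toFun))
    (b : BoundaryData (𝓡∂ 4) X (𝓡 3)) [Nonempty b.carrier] :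
    ∃ (C : b.OpenCollar) (a : ℝ), 0 < a ∧
      ∀ (i : ι) (θ : Metric.sphere (0 : EuclideanSpace ℝ (Fin 2)) 1) (v : EuclideanSpace ℝ (Fin 2)),
        ‖v‖ ≤ 1 / 2 → ∀ z : b.carrier, b.incl z = (f i).toFun (depthLine θ v 0) →
        ∀ s : ℝ, 0 ≤ s → collarStretch a s ≤ min (1 / 5) a →
          C.toFun z s = (f i).toFun (depthLine θ v (collarStretch a s)) := by
  obtain ⟨D, Γ, hΓ⟩ := exists_adapted_flowout f hdisj
  refine ⟨Γ.openCollar b, Γ.a, Γ.a_pos, fun i θ v hv z hz s hs hcs => ?_⟩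
  show Γ.Fl (b.incl z) (collarStretch Γ.a s) = _
  rw [hz]
  exact hΓ i θ v hv _ ⟨collarStretch_nonneg Γ.a_pos hs, hcs⟩

/-- **Registered helper `helper_openCollar_adapted` (brick (ii-a) of T3b, sub-goal of NF6
`stub_steinRealisation`, wave 2, lead c5): an open collar of `∂X` adapted to a finite family of
attaching maps of 2-handles** — its collar lines near the attaching circles are the depth lines of
the tubes (Milnor's flow-out collar with prescribed germs). [cite: MilnorHCobordism1965, proof of Thm. 3.4] -/
theorem helper_openCollar_adapted : ∀ {X : Type} [TopologicalSpace X] [T2Space X] [CompactSpace X] [ChartedSpace (EuclideanHalfSpace 4) X] [IsManifold (𝓡∂ 4) ∞ X] {ι : Type} [Finite ι] (f : ι → Literature.Topology.FourManifolds.HandleAttachingMap 3 2 X), (Pairwise fun i j => Disjoint (Set.range (f i).toFun) (Set.range (f j).toFun)) → ∀ (b : Literature.Topology.FourManifolds.BoundaryData (𝓡∂ 4) X (𝓡 3)) [Nonempty b.carrier], ∃ (C : b.OpenCollar) (a : ℝ), 0 < a ∧ ∀ (i : ι) (θ : Metric.sphere (0 : EuclideanSpace ℝ (Fin 2)) 1)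 (v : EuclideanSpace ℝ (Fin 2)), ‖v‖ ≤ 1 / 2 → ∀ z : b.carrier, b.incl z = (f i).toFun (Literature.Topology.FourManifolds.depthLine θ v 0) → ∀ s : ℝ, 0 ≤ s → Literature.Topology.FourManifolds.collarStretch a s ≤ min (1 / 5) a → C.toFun z s = (f i).toFun (Literature.Topology.FourManifolds.depthLine θ v (Literature.Topology.FourManifolds.collarStretch a s)) :=
  fun f hdisj b _ => exists_openCollar_adapted f hdisj b

end Adapted

/-! ### §2 An open collar of `bW` and a matched collar of the canonical boundary datum -/

section Matched

variable {W : Type u} [TopologicalSpace W] [T2Space W] [CompactSpace W]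
  [ChartedSpace (EuclideanHalfSpace 4) W] [IsManifold (𝓡∂ 4) ∞ W]

/-- **An open collar of `bW` and a collar of the canonical boundary datum from ONE flow-out.**  For
a boundary datum `bW` of the compact `W` with nonempty carrier there are a long open collar `CN` of
`bW` and a collar `col` of the canonical boundary datum `BoundaryManifold.boundaryData 3 W`
(`Cobordism.lean`) such that `col (w, t) = CN.toFun x (t / (2 - t))` for `t ∈ [0, 1]` whenever the
two boundary parametrisations agree, `(boundaryData 3 W).incl w = bW.incl x` (both are Milnor's
flow-out `Fl` of the same data, with the parameters `t a / 2` and `a s / (1 + s)`).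
[cite: MilnorHCobordism1965, proof of Thm. 3.4] -/
theorem exists_openCollar_collar_eq (bW : BoundaryData (𝓡∂ 4) W (𝓡 3)) [Nonempty bW.carrier] :
    ∃ (CN : bW.OpenCollar) (col : (BoundaryManifold.boundaryData 3 W).Collar),
      ∀ (w : (BoundaryManifold.boundaryData 3 W).carrier) (x : bW.carrier),
        (BoundaryManifold.boundaryData 3 W).incl w = bW.incl x →
        ∀ t : Set.Icc (0 : ℝ) 1, col.toFun (w, t) = CN.toFun x ((t : ℝ) / (2 - t)) := by
  obtain ⟨D⟩ := FlowoutInput.nonempty_of_compactSpace (n := 3) (M := W)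
  obtain ⟨Γ⟩ := D.nonempty_cover
  haveI : Nonempty (BoundaryManifold.boundaryData 3 W).carrier := by
    obtain ⟨x⟩ := (inferInstance : Nonempty bW.carrier)
    exact ⟨⟨bW.incl x, bW.incl_mem_boundary x⟩⟩
  refine ⟨Γ.openCollar bW, (Γ.openCollarData (BoundaryManifold.boundaryData 3 W)).toCollar,
    fun w x hwx t => ?_⟩
  have ht0 : (0 : ℝ) ≤ t := t.2.1
  have ht1 : (t : ℝ) ≤ 1 := t.2.2
  have h2t : 0 < 2 - (t : ℝ) := by linarith
  show Γ.Fl ((BoundaryManifold.boundaryData 3 W).incl w) ((t : ℝ) * (Γ.a / 2)) =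
    Γ.Fl (bW.incl x) (collarStretch Γ.a ((t : ℝ) / (2 - t)))
  rw [hwx]
  congr 1
  rw [collarStretch]
  field_simp
  ring

end Matched

/-! ### §3 Standard form of the seam -/

section Standard

variable {X : Type u} [TopologicalSpace X] [T2Space X] [CompactSpace X]
  [ChartedSpace (EuclideanHalfSpace 4) X] [IsManifold (𝓡∂ 4) ∞ X]
  {W : Type u} [TopologicalSpace W] [T2Space W] [CompactSpace W]
  [ChartedSpace (EuclideanHalfSpace 4) W] [IsManifold (𝓡∂ 4) ∞ W]
  {bX : BoundaryData (𝓡∂ 4) X (𝓡 3)} {bW : BoundaryData (𝓡∂ 4) W (𝓡 3)}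

/-- **Standard form of the seam.**  If the closed `M` is the gluing of the compact `X`, `W` along
`Ψ : ∂X ≅ ∂W`, then for ANY long open collars `CM` of `bX` and `CN` of `bW`, `M` is diffeomorphic to
Milnor's explicit gluing `(⟨CM, CN, Ψ⟩ : BoundaryGlueData bX bW).d₂.Glued` — in which the seam piece
`∂X × ℝ` is a chart, `jM (CM z t) = ι (z, t)` and `jN (CN (Ψ z) s) = ι (z, -s)`
(`BoundaryGlueData.jM_toFun`, `.jN_toFun`) — by the uniqueness of gluings (Hirsch 1976, Ch. 8,
Thm. 2.1; the tree's `nonempty_diffeomorph_of_isBoundaryGluing_holds`).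
[cite: HirschDT1976, Ch. 8 §2, Thm. 2.1] -/
theorem exists_diffeomorph_glued [Nonempty bX.carrier] (Ψ : bX.carrier ≃ₘ⟮𝓡 3, 𝓡 3⟯ bW.carrier)
    {M : Type u} [TopologicalSpace M] [ChartedSpace (EuclideanSpace ℝ (Fin 4)) M]
    [IsManifold (𝓡 4) ∞ M] (hglue : IsBoundaryGluing bX bW Ψ (𝓡 4) M)
    (CM : bX.OpenCollar) (CN : bW.OpenCollar) :
    Nonempty (M ≃ₘ⟮𝓡 4, 𝓡 4⟯ (⟨CM, CN, Ψ⟩ : BoundaryGlueData bX bW).d₂.Glued) :=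
  nonempty_diffeomorph_of_isBoundaryGluing_holds hglue
    ((⟨CM, CN, Ψ⟩ : BoundaryGlueData bX bW).isBoundaryGluing)

/-- **The conclusion "`M = X₁ ∪_φ W₂`" transports back from the standard form**: a gluing
presentation of a manifold `M'` along `φ` is one of any `M ≅ M'`. [cite: HirschDT1976, Ch. 8 §2] -/
theorem isBoundaryGluing_of_diffeomorph {X₁ : Type u} [TopologicalSpace X₁]
    [ChartedSpace (EuclideanHalfSpace 4) X₁] {W₂ : Type u} [TopologicalSpace W₂]
    [ChartedSpace (EuclideanHalfSpace 4) W₂] {b₁ : BoundaryData (𝓡∂ 4) X₁ (𝓡 3)}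
    {b₂ : BoundaryData (𝓡∂ 4) W₂ (𝓡 3)} {φ : b₁.carrier → b₂.carrier}
    {M M' : Type u} [TopologicalSpace M] [ChartedSpace (EuclideanSpace ℝ (Fin 4)) M]
    [IsManifold (𝓡 4) ∞ M] [TopologicalSpace M'] [ChartedSpace (EuclideanSpace ℝ (Fin 4)) M']
    [IsManifold (𝓡 4) ∞ M'] (h : IsBoundaryGluing b₁ b₂ φ (𝓡 4) M') (e : M ≃ₘ⟮𝓡 4, 𝓡 4⟯ M') :
    IsBoundaryGluing b₁ b₂ φ (𝓡 4) M :=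
  h.diffeomorph_comp e.symm

end Standard

end Summit.SmoothPoincare4.SmoothPoincare4.Theorems.AcyclicBisectionExists.ModpBraidOrbits

end
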